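import Literature.NumberTheory.EllipticCurves.ShaRestrictionJZeroCorestriction
import Literature.NumberTheory.EllipticCurves.SelmerPInftyModelAction
import HarnessLib

/-!
# `res : Ш(E/ℚ) ⥲ Ш(E_K/K)^{Gal(K/ℚ)}` for `j = 0` short models and `K = ℚ(ω)`

The exact descent of `H¹` and `Ш` along `K = ℚ(ω) ⊇ ℚ` for an elliptic curve `E : y² = x³ + B`
over `ℚ` (all of `a₁, …, a₄` zero), assembled on the tree's objects `(W.baseChange K).galH1`,
`resBaseChange`, `shaRestriction` and the action `IsLiftOfAut.conjH1Points` of the chosen lift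
`τ = liftAut σ` of the generator `σ` of `Gal(K/ℚ)`:

* `JZero.exists_resBaseChange_eq_of_conjH1Points_eq` — every `τ_*`-invariant class of
  `H¹(K, E_K)` is a restriction; with `conjH1Points_resBaseChange` (`τ_* ∘ res = res`,
  `ShaRestrictionJZeroDescent`): `JZero.range_resBaseChange_eq` — `res(H¹(ℚ, E)) = H¹(K, E_K)^{τ}`;
* `JZero.exists_shaRestriction_eq_of_conjH1Points_eq`, `JZero.range_shaRestriction_eq` — the same
  for `Ш` (`Ш(E/ℚ) = res⁻¹ Ш(E_K/K)`, `ShaRestrictionJZeroLocalDescent`), so that with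
  `JZero.shaRestriction_injective` the restriction is a bijection `Ш(E/ℚ) ≅ Ш(E_K/K)^{τ}`
  (`JZero.shaRestriction_bijective_codRestrict`-style statement `JZero.exists_unique_shaRestriction_eq`).

Proof: transport of the subgroup-model statement `JZero.exists_resSubgroupH1_eq_of_conjH1_eq`
(`ShaRestrictionJZeroCorestriction`) through the model isomorphism
`H¹(Γ_K, E_K(K̄)) ≅ H¹(galRange K, E(ℚ̄))` of the compatible pairs
`(rangeToResGal, θ⁻¹)`, `(resGalToRange, θ)` with `θ : E(ℚ̄) ≃ E_K(K̄)` the chosen embedding on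
coordinates (the full-points version of the tree's `modelIso` for `E[p^∞]`,
`SelmerPInftyRestriction` / `SelmerPInftyModelAction`): under it `resBaseChange` becomes
`resSubgroupH1` and `τ_*` becomes the conjugation `c_*` by `c = liftToAbsGal K σ`
(`resGal_conjGalCMH`, `localPointsEquivGeomPoints_pointsMap_smul`). Everything here is proved; no
new definitions (the model isomorphism is built inside the proof).

## References

* J.-P. Serre, *Galois Cohomology* (1997), I.§2.4–2.5, I.§5.8. [SerreGaloisCohomology1997]
* B. H. Gross, Kolyvagin's work on modular elliptic curves (1991), §5 (5.1)–(5.2). [GrossLMS1991]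
* J. H. Silverman, *The Arithmetic of Elliptic Curves*, 2nd ed. (2009), III.10.1. [SilvermanAEC2009]
-/

noncomputable section

open scoped Classical

namespace Literature.NumberTheory.EllipticCurves

open GaloisRepresentations WeierstrassCurve

namespace JZero

variable (K : Type) [Field K] [NumberField K] (W : WeierstrassCurve ℚ) [W.IsElliptic]

omit [NumberField K] [W.IsElliptic] in
/-- A primitive cube root of unity satisfies `ζ² + ζ + 1 = 0`. [folklore] -/
private theorem sq_add_self_add_one_eq_zero {ζ : K} (hζ : IsPrimitiveRoot ζ 3) :
    ζ ^ 2 + ζ + 1 = 0 := by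
  have h3 : ζ ^ 3 = 1 := hζ.pow_eq_one
  have h1 : ζ ≠ 1 := hζ.ne_one (by norm_num)
  have hprod : (ζ - 1) * (ζ ^ 2 + ζ + 1) = 0 := by linear_combination h3
  rcases mul_eq_zero.mp hprod with h | h
  · exact absurd (sub_eq_zero.mp h) h1
  · exact h

omit [W.IsElliptic] in
/-- `σ ζ = ζ²` for a primitive cube root of unity forces `σ ≠ 1`. [folklore] -/
private theorem ne_one_of_apply_eq_sq' {ζ : K} (hζ : IsPrimitiveRoot ζ 3) {σ : K ≃ₐ[ℚ] K}
    (hσζ : σ ζ = ζ ^ 2) : σ ≠ 1 := by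
  intro h
  rw [h, AlgEquiv.one_apply] at hσζ
  have hζ0 : ζ ≠ 0 := hζ.ne_zero (by norm_num)
  have hζ1 : ζ ≠ 1 := hζ.ne_one (by norm_num)
  have : ζ * (ζ - 1) = 0 := by linear_combination hσζ.symm
  rcases mul_eq_zero.mp this with h0 | h0
  · exact hζ0 h0
  · exact hζ1 (sub_eq_zero.mp h0)

/-- **INVARIANT CLASSES OF `H¹(K, E_K)` ARE RESTRICTIONS.** `E = W/ℚ` elliptic with all of
`a₁, …, a₄` zero (`y² = x³ + B`), `K` a quadratic number field with a primitive cube root of unity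
`ζ` (`K ≅ ℚ(ω)`), `σ ∈ Aut(K/ℚ)` with `σ ζ = ζ²`, `τ = liftAut σ` its chosen lift to `K̄`. Every
class `s ∈ H¹(K, E_K)` with `τ_* s = s` (`IsLiftOfAut.conjH1Points`) is `res c` for some
`c ∈ H¹(ℚ, E)` (`resBaseChange`). Proof: under the model isomorphism
`Φ : H¹(Γ_K, E_K(K̄)) → H¹(galRange K, E(ℚ̄))` of the pair `(rangeToResGal, θ⁻¹)` — injective, with
`Φ ∘ res = resSubgroupH1` and `Φ ∘ τ_* = c_* ∘ Φ` for `c = liftToAbsGal K σ` — this is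
`JZero.exists_resSubgroupH1_eq_of_conjH1_eq` (CM corestriction `c₀ = cor(−[ω]_* s)`).
Gross 1991 §5 (5.1)–(5.2) (the odd-`p` Heegner analogue); Serre, *Galois Cohomology*, I.§2.4–2.5.
[cite: SerreGaloisCohomology1997, I.§2.4 (Prop. 9 and Cor.) and I.§5.8]
[cite: GrossLMS1991, §5 (5.1)] -/
theorem exists_resBaseChange_eq_of_conjH1Points_eq (ha₁ : W.a₁ = 0) (ha₂ : W.a₂ = 0)
    (ha₃ : W.a₃ = 0) (ha₄ : W.a₄ = 0) (h2 : Module.finrank ℚ K = 2) {ζ : K}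
    (hζ : IsPrimitiveRoot ζ 3) {σ : K ≃ₐ[ℚ] K} (hσζ : σ ζ = ζ ^ 2) {s : (W.baseChange K).galH1}
    (hs : (isLiftOfAut_liftAut σ).conjH1Points W s = s) :
    ∃ c : W.galH1, resBaseChange W K c = s := by
  haveI : IsGalois ℚ K := by
    haveI : Algebra.IsQuadraticExtension ℚ K := ⟨h2⟩
    infer_instance
  have hσ1 : σ ≠ 1 := ne_one_of_apply_eq_sq' K hζ hσζ
  haveI hNn : (galRange (K := ℚ) K).Normal := normal_galRange K h2 hσ1
  -- the coefficient isomorphism `θ : E(ℚ̄) ≃ E_K(K̄)` (the chosen embedding on coordinates)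
  have hθ₀ : Function.Bijective
      ((localPointsEquivGeomPoints W K).toAddMonoidHom.comp (pointsMap W K)) :=
    (localPointsEquivGeomPoints W K).bijective.comp
      (pointsMapOfEmb_bijective K W (closureEmb (K := ℚ) K))
  obtain ⟨θ, hθ⟩ : ∃ θ : geomPoints W ≃+ geomPoints (W.baseChange K),
      ∀ P, θ P = localPointsEquivGeomPoints W K (pointsMap W K P) :=
    ⟨AddEquiv.ofBijective _ hθ₀, fun _ ↦ rfl⟩
  have hθ_smul : ∀ (g : Field.absoluteGaloisGroup K) (P : geomPoints W),
      θ (resGal (K := ℚ) K g • P) = g • θ P := fun g P ↦ by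
    rw [hθ, hθ, pointsMap_smul, localPointsEquivGeomPoints_smul]
  have hθ_symm_smul : ∀ (n : galRange (K := ℚ) K) (Q : geomPoints (W.baseChange K)),
      θ.symm (rangeToResGal (K := ℚ) K n • Q) = n • θ.symm Q := fun n Q ↦ by
    apply θ.injective
    rw [AddEquiv.apply_symm_apply]
    have e : θ (n • θ.symm Q) = θ (resGal (K := ℚ) K (rangeToResGal (K := ℚ) K n) • θ.symm Q) := by
      rw [resGal_rangeToResGal]
      rfl
    rw [e, hθ_smul, AddEquiv.apply_symm_apply]
  have hθ_c : ∀ Q : geomPoints W,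
      θ (liftToAbsGal (K := ℚ) K σ • Q) = (isLiftOfAut_liftAut σ).pointsMap W (θ Q) := fun Q ↦ by
    rw [hθ, hθ]
    exact localPointsEquivGeomPoints_pointsMap_smul W σ Q
  -- the model isomorphism `Φ` and its left inverse `Ψ`
  obtain ⟨Φ, hΦ⟩ : ∃ Φ : (W.baseChange K).galH1 →+ subgroupH1 (galRange (K := ℚ) K) (geomPoints W),
      Φ = resH1Hom (rangeToResGal (K := ℚ) K) θ.symm.toAddMonoidHom hθ_symm_smul := ⟨_, rfl⟩
  have hΨ_smul : ∀ (g : Field.absoluteGaloisGroup K) (P : geomPoints W),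
      θ (resGalToRange (K := ℚ) K g • P) = g • θ P := fun g P ↦ hθ_smul g P
  obtain ⟨Ψ, hΨ⟩ : ∃ Ψ : subgroupH1 (galRange (K := ℚ) K) (geomPoints W) →+ (W.baseChange K).galH1,
      Ψ = resH1Hom (resGalToRange (K := ℚ) K) θ.toAddMonoidHom hΨ_smul := ⟨_, rfl⟩
  have hΨΦ : ∀ x, Ψ (Φ x) = x := fun x ↦ by
    rw [hΦ, hΨ, resH1Hom_resH1Hom]
    have e : resH1Hom ((rangeToResGal (K := ℚ) K).comp (resGalToRange (K := ℚ) K))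
        (θ.toAddMonoidHom.comp θ.symm.toAddMonoidHom)
        (fun x m ↦ by
          simp only [AddMonoidHom.coe_comp, Function.comp_apply, ContinuousMonoidHom.comp_toFun,
            AddEquiv.coe_toAddMonoidHom, hθ_symm_smul, hΨ_smul]) =
          resH1Hom (ContinuousMonoidHom.id _) (AddMonoidHom.id _) (fun _ _ ↦ rfl) :=
      resH1Hom_congr (by ext g; exact rangeToResGal_resGalToRange K g)
        (by ext Q; exact θ.apply_symm_apply Q) _ _
    rw [e, resH1Hom_id]
    rfl
  -- `Φ ∘ res = resSubgroupH1`
  have hΦres : ∀ η : W.galH1,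
      Φ (resBaseChange W K η) = resSubgroupH1 (galRange (K := ℚ) K) (geomPoints W) η := fun η ↦ by
    rw [hΦ]
    change resH1Hom (rangeToResGal (K := ℚ) K) θ.symm.toAddMonoidHom hθ_symm_smul
      (h1Equiv (localPointsEquivGeomPoints W K) (localPointsEquivGeomPoints_smul W K)
        (resH1Hom (resGal (K := ℚ) K) (pointsMap W K) (pointsMap_smul W K) η)) = _
    rw [h1Equiv_apply, resH1Hom_resH1Hom, resH1Hom_resH1Hom]
    have hG : ((resGal (K := ℚ) K).comp (ContinuousMonoidHom.id _)).comp
        (rangeToResGal (K := ℚ) K) = subgroupIncl (galRange (K := ℚ) K) := by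
      apply ContinuousMonoidHom.ext
      intro n
      exact resGal_rangeToResGal K n
    have hM : (θ.symm.toAddMonoidHom.comp
        ((localPointsEquivGeomPoints W K : localPoints W K →+ geomPoints (W.baseChange K)).comp
          (pointsMap W K))) = AddMonoidHom.id (geomPoints W) := by
      refine AddMonoidHom.ext fun P ↦ ?_
      apply θ.injective
      change θ (θ.symm (localPointsEquivGeomPoints W K (pointsMap W K P))) = θ P
      rw [AddEquiv.apply_symm_apply, hθ]
    exact congrFun (congrArg DFunLike.coe (resH1Hom_congr hG hM _ _)) η
  -- `Φ ∘ τ_* = c_* ∘ Φ`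
  have hΦconj : ∀ x : (W.baseChange K).galH1,
      Φ ((isLiftOfAut_liftAut σ).conjH1Points W x) =
        conjH1 (galRange (K := ℚ) K) (geomPoints W) (liftToAbsGal (K := ℚ) K σ) (Φ x) := fun x ↦ by
    have hG : ((isLiftOfAut_liftAut σ).conjGalCMH).comp (rangeToResGal (K := ℚ) K) =
        (rangeToResGal (K := ℚ) K).comp
          (subgroupConj (galRange (K := ℚ) K) (liftToAbsGal (K := ℚ) K σ)) := by
      apply ContinuousMonoidHom.ext
      intro n
      apply resGal_injective (K := ℚ) K
      change resGal (K := ℚ) K ((isLiftOfAut_liftAut σ).conjGalCMH (rangeToResGal (K := ℚ) K n)) =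
        resGal (K := ℚ) K (rangeToResGal (K := ℚ) K
          (subgroupConj (galRange (K := ℚ) K) (liftToAbsGal (K := ℚ) K σ) n))
      rw [resGal_conjGalCMH, resGal_rangeToResGal, resGal_rangeToResGal, subgroupConj_apply_coe]
    have hM : (θ.symm.toAddMonoidHom).comp ((isLiftOfAut_liftAut σ).pointsMap W) =
        (DistribSMul.toAddMonoidHom (geomPoints W) (liftToAbsGal (K := ℚ) K σ)).comp
          θ.symm.toAddMonoidHom := by
      refine AddMonoidHom.ext fun m ↦ ?_
      apply θ.injective
      change θ (θ.symm ((isLiftOfAut_liftAut σ).pointsMap W m)) =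
        θ (liftToAbsGal (K := ℚ) K σ • θ.symm m)
      rw [AddEquiv.apply_symm_apply, hθ_c, AddEquiv.apply_symm_apply]
    rw [hΦ, IsLiftOfAut.conjH1Points, conjH1, resH1Hom_resH1Hom, resH1Hom_resH1Hom]
    exact congrFun (congrArg DFunLike.coe (resH1Hom_congr hG hM _ _)) x
  -- conclude by CM corestriction in the subgroup model
  have hξ : conjH1 (galRange (K := ℚ) K) (geomPoints W) (liftToAbsGal (K := ℚ) K σ) (Φ s) = Φ s := by
    rw [← hΦconj, hs]
  obtain ⟨η, hη⟩ := exists_resSubgroupH1_eq_of_conjH1_eq W K ha₁ ha₂ ha₃ ha₄ h2 hζ hσζ hξ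
  refine ⟨η, ?_⟩
  have e1 : Φ (resBaseChange W K η) = Φ s := by rw [hΦres, hη]
  calc resBaseChange W K η = Ψ (Φ (resBaseChange W K η)) := (hΨΦ _).symm
    _ = Ψ (Φ s) := by rw [e1]
    _ = s := hΨΦ s

/-- **`res(H¹(ℚ, E)) = H¹(K, E_K)^{τ}`** (set form of `exists_resBaseChange_eq_of_conjH1Points_eq`
with `conjH1Points_resBaseChange`). [cite: SerreGaloisCohomology1997, I.§2.4 (Prop. 9 and Cor.) and I.§5.8]
[cite: GrossLMS1991, §5 (5.1)] -/
theorem range_resBaseChange_eq (ha₁ : W.a₁ = 0) (ha₂ : W.a₂ = 0) (ha₃ : W.a₃ = 0) (ha₄ : W.a₄ = 0)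
    (h2 : Module.finrank ℚ K = 2) {ζ : K} (hζ : IsPrimitiveRoot ζ 3) {σ : K ≃ₐ[ℚ] K}
    (hσζ : σ ζ = ζ ^ 2) :
    ((resBaseChange W K).range : Set (W.baseChange K).galH1) =
      {s | (isLiftOfAut_liftAut σ).conjH1Points W s = s} := by
  ext s
  simp only [SetLike.mem_coe, AddMonoidHom.mem_range, Set.mem_setOf_eq]
  constructor
  · rintro ⟨c, rfl⟩
    exact conjH1Points_resBaseChange W K (isLiftOfAut_liftAut σ) c
  · exact fun hs ↦ exists_resBaseChange_eq_of_conjH1Points_eq K W ha₁ ha₂ ha₃ ha₄ h2 hζ hσζ hs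

/-- **INVARIANT CLASSES OF `Ш(E_K/K)` COME FROM `Ш(E/ℚ)`**: for `s ∈ Ш(E_K/K)` with `τ_* s = s`
there is `s₀ ∈ Ш(E/ℚ)` with `res s₀ = s` (`exists_resBaseChange_eq_of_conjH1Points_eq`, and the
preimage lies in `Ш(E/ℚ)` by the exact local descent `JZero.mem_sha_of_resBaseChange_mem_sha_rat`).
This is LEMMA K0's "`𝒜⁺ = res Ш(E/ℚ)`" for the cube-sum frame `K = ℚ(√−3)`.
[cite: SerreGaloisCohomology1997, I.§2.4 (Prop. 9 and Cor.) and I.§5.8] [cite: GrossLMS1991, §5 (5.1)] -/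
theorem exists_shaRestriction_eq_of_conjH1Points_eq (ha₁ : W.a₁ = 0) (ha₂ : W.a₂ = 0)
    (ha₃ : W.a₃ = 0) (ha₄ : W.a₄ = 0) (h2 : Module.finrank ℚ K = 2) {ζ : K}
    (hζ : IsPrimitiveRoot ζ 3) {σ : K ≃ₐ[ℚ] K} (hσζ : σ ζ = ζ ^ 2) {s : (W.baseChange K).sha}
    (hs : (isLiftOfAut_liftAut σ).conjH1Points W (s : (W.baseChange K).galH1) = s) :
    ∃ s₀ : W.sha, shaRestriction W K s₀ = s := by
  obtain ⟨c, hc⟩ := exists_resBaseChange_eq_of_conjH1Points_eq K W ha₁ ha₂ ha₃ ha₄ h2 hζ hσζ hs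
  have hcsha : c ∈ W.sha :=
    mem_sha_of_resBaseChange_mem_sha_rat W ha₁ ha₂ ha₃ ha₄ K (sq_add_self_add_one_eq_zero K hζ) h2
      (by rw [hc]; exact s.2)
  refine ⟨⟨c, hcsha⟩, Subtype.ext ?_⟩
  rw [coe_shaRestriction_apply]
  exact hc

/-- **`res(Ш(E/ℚ)) = Ш(E_K/K)^{τ}`** (set form, with `conjH1Points_shaRestriction`).
[cite: SerreGaloisCohomology1997, I.§2.4 (Prop. 9 and Cor.) and I.§5.8] [cite: GrossLMS1991, §5 (5.1)] -/
theorem range_shaRestriction_eq (ha₁ : W.a₁ = 0) (ha₂ : W.a₂ = 0) (ha₃ : W.a₃ = 0)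
    (ha₄ : W.a₄ = 0) (h2 : Module.finrank ℚ K = 2) {ζ : K} (hζ : IsPrimitiveRoot ζ 3)
    {σ : K ≃ₐ[ℚ] K} (hσζ : σ ζ = ζ ^ 2) :
    ((shaRestriction W K).range : Set (W.baseChange K).sha) =
      {s : (W.baseChange K).sha |
        (isLiftOfAut_liftAut σ).conjH1Points W (s : (W.baseChange K).galH1) = s} := by
  ext s
  simp only [SetLike.mem_coe, AddMonoidHom.mem_range, Set.mem_setOf_eq]
  constructor
  · rintro ⟨s₀, rfl⟩
    exact conjH1Points_shaRestriction W K (isLiftOfAut_liftAut σ) s₀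
  · exact fun hs ↦ exists_shaRestriction_eq_of_conjH1Points_eq K W ha₁ ha₂ ha₃ ha₄ h2 hζ hσζ hs

/-- **`res : Ш(E/ℚ) ⥲ Ш(E_K/K)^{τ}` — LEMMA K0 in the cube-sum frame.** For `E : y² = x³ + B`
over `ℚ`, `K` a quadratic number field with a primitive cube root of unity `ζ`, `σ ζ = ζ²`,
`τ = liftAut σ`: every `τ_*`-invariant element of `Ш(E_K/K)` has EXACTLY ONE preimage in `Ш(E/ℚ)`
under `shaRestriction` (existence: `exists_shaRestriction_eq_of_conjH1Points_eq`; uniqueness: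
`JZero.shaRestriction_injective_of_isPrimitiveRoot`), and conversely every restricted class is
invariant (`conjH1Points_shaRestriction`). Gross 1991 §5 (5.1)–(5.2) (Heegner analogue, odd `p`).
[cite: GrossLMS1991, §5 (5.1)] [cite: SerreGaloisCohomology1997, I.§2.4 (Prop. 9 and Cor.) and I.§5.8] -/
theorem existsUnique_shaRestriction_eq_of_conjH1Points_eq (ha₁ : W.a₁ = 0) (ha₂ : W.a₂ = 0)
    (ha₃ : W.a₃ = 0) (ha₄ : W.a₄ = 0) (h2 : Module.finrank ℚ K = 2) {ζ : K}
    (hζ : IsPrimitiveRoot ζ 3) {σ : K ≃ₐ[ℚ] K} (hσζ : σ ζ = ζ ^ 2) {s : (W.baseChange K).sha}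
    (hs : (isLiftOfAut_liftAut σ).conjH1Points W (s : (W.baseChange K).galH1) = s) :
    ∃! s₀ : W.sha, shaRestriction W K s₀ = s := by
  obtain ⟨s₀, hs₀⟩ := exists_shaRestriction_eq_of_conjH1Points_eq K W ha₁ ha₂ ha₃ ha₄ h2 hζ hσζ hs
  exact ⟨s₀, hs₀, fun s₁ hs₁ ↦
    shaRestriction_injective_of_isPrimitiveRoot W K ha₁ ha₂ ha₃ ha₄ h2 hζ hσζ (hs₁.trans hs₀.symm)⟩

end JZero

end Literature.NumberTheory.EllipticCurves
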